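import Literature.NumberTheory.EllipticCurves.SelmerRestrictionCorank
import Literature.NumberTheory.EllipticCurves.SelmerGroupOverTorsionFinite
import Literature.NumberTheory.EllipticCurves.ZpCorankCyclicPowerAction
import HarnessLib

/-!
# The parity of the `p^∞`-Selmer rank is unchanged in cyclic `p`-power extensions (Dokchitser–Dokchitser 2010, Cor. 4.15)

T. Dokchitser, V. Dokchitser, *On the Birch–Swinnerton-Dyer quotients modulo squares*, Ann. of
Math. 172 (2010), Cor. 4.15 (arXiv:math/0610290, Cor. 48): "A cyclic group of order `p` has only
two `ℚ_p`-irreducible `p`-adic representations, the trivial one and one of dimension `p − 1`.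
Thus, the parity of the `p^∞`-Selmer rank is unchanged in cyclic `p`-extensions" (`p` odd, the
standing assumption of §4.5); iterated up a cyclic tower of `p`-power degree in §4.6 (proof of
Thm. 4.19: "the same holds for the `p^∞`-Selmer rank (Corollary 4.15)" over the layers `M_n` of
the anticyclotomic `ℤ_p`-extension).

This file PROVES it in the tree's subgroup model of Selmer groups over extensions
(`WeierstrassCurve.selmerGroupOver W p H`, `F = K̄^H`; file `SubgroupSelmer`):

* `selmerCorank_mod_two_eq_zpCorank_selmerGroupOver_of_cyclic` — for an elliptic curve `E = W`
  over a number field `K`, an odd prime `p`, and an open normal subgroup `H ≤ Γ_K` with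
  `Γ_K / H` cyclic of order `p^n` (every `g ∈ Γ_K` is `h c^k`, `h ∈ H`, and `[Γ_K : H] = p^n`):
  `rk_p(E/K) ≡ rk_p(E/F) (mod 2)`, i.e.
  `W.selmerCorank p % 2 = zpCorank (Sel_{p^∞}(E/F)) p % 2`.

Proof, as printed: `rk_p(E/K) = corank Sel_{p^∞}(E/F)^G` (Lemma 4.14, the tree's
`selmerCorank_eq_zpCorank_selmerGroupOverInvariants`, with the finiteness of `Sel_{p^∞}(E/F)[p]`,
`finite_torsionBy_selmerGroupOver`), and `corank Sel_{p^∞}(E/F) ≡ corank Sel_{p^∞}(E/F)^G (mod 2)`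
because `G = ⟨c H⟩` is cyclic of `p`-power order acting through the conjugation `c_*`
(`zpCorank_mod_two_eq_of_pow_prime_pow_eq_id`: the non-trivial `ℚ_p`-irreducibles of a cyclic
`p`-group have even dimension), the `G`-invariants being the `c_*`-invariants
(`conjH1_eq_self_of_generator`). Everything here is proved; no named fact is introduced.

## References

* T. Dokchitser, V. Dokchitser, Ann. of Math. 172 (2010) = arXiv:math/0610290, Lemma 4.14,
  Cor. 4.15 (arXiv: Lemma 47, Cor. 48), §4.6. [DokchitserDokchitserAnnals2010]
* R. Greenberg, LNM 1716 (1999), §2. [GreenbergLNM1716]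
-/

noncomputable section

open scoped Classical AddSubgroup

namespace WeierstrassCurve

open Literature.NumberTheory.EllipticCurves Literature.NumberTheory.GaloisRepresentations

variable {K : Type} [Field K] [NumberField K] (W : WeierstrassCurve K) (p : ℕ) [Fact p.Prime]
variable (H : Subgroup (Field.absoluteGaloisGroup K)) [H.Normal] [H.FiniteIndex]

variable [W.IsElliptic]

/-- **Dokchitser–Dokchitser 2010, Cor. 4.15 (cyclic `p`-power extensions, subgroup model).** For
an elliptic curve `E = W` over a number field `K`, an odd prime `p`, and an open normal subgroup
`H ≤ Γ_K` such that `G = Γ_K/H` is cyclic of order `p^n` — witnessed by `c ∈ Γ_K` with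
`Γ_K = ⋃_k H c^k` and `[Γ_K : H] = p^n` — the `p^∞`-Selmer ranks of `E` over `K` and over
`F = K̄^H` have the same parity:
`corank_{ℤ_p} Sel_{p^∞}(E/K) ≡ corank_{ℤ_p} Sel_{p^∞}(E/F) (mod 2)`. Printed proof: Lemma 4.14
(`rk_p(E/K) = dim X_p(E/F)^G`) and "a cyclic group of order `p` has only two `ℚ_p`-irreducible
`p`-adic representations, the trivial one and one of dimension `p − 1`" (for order `p^n`: the
non-trivial ones have even dimension `φ(p^k)`), here `selmerCorank_eq_zpCorank_selmerGroupOverInvariants`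
and `zpCorank_mod_two_eq_of_pow_prime_pow_eq_id` for the conjugation `c_*` on `Sel_{p^∞}(E/F)`
(stable: `map_conjH1_selmerGroupOver_le_holds`; `(c_*)^{p^n} = (c^{p^n})_* = id` as
`c^{[Γ_K:H]} ∈ H`), whose invariants are the `G`-invariants (`conjH1_eq_self_of_generator`).
[cite: DokchitserDokchitserAnnals2010, Cor. 4.15 (with Lemma 4.14)] -/
theorem selmerCorank_mod_two_eq_zpCorank_selmerGroupOver_of_cyclic (hp2 : p ≠ 2)
    (hH : IsOpen (H : Set (Field.absoluteGaloisGroup K))) {c : Field.absoluteGaloisGroup K}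
    (hc : ∀ g : Field.absoluteGaloisGroup K, ∃ (h : H) (k : ℕ), g = h * c ^ k) {n : ℕ}
    (hidx : H.index = p ^ n) :
    W.selmerCorank p % 2 = zpCorank (W.selmerGroupOver p H) p % 2 := by
  -- notation
  set T := W.selmerGroupOver p H with hT
  haveI : Finite T[(p : ℤ)] := finite_torsionBy_selmerGroupOver W p H hH
  haveI : CompactSpace (Field.absoluteGaloisGroup K) := compactSpace_absoluteGaloisGroup K
  have hM : ∀ m : geomPrimaryTorsion W p, ∃ k : ℕ, p ^ k • m = 0 := fun m ↦ by
    obtain ⟨k, hk⟩ := AddCommGroup.mem_primaryComponent.mp m.2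
    exact ⟨k, Subtype.ext (by rw [AddSubmonoidClass.coe_nsmul, hk, ZeroMemClass.coe_zero])⟩
  have hTprim : ∀ t : T, ∃ m : ℕ, p ^ m • t = 0 := fun t ↦ by
    obtain ⟨m, hm⟩ := exists_pow_nsmul_eq_zero_subgroupH1 H (Subgroup.isClosed_of_isOpen H hH)
      hM (t : W.subgroupH1 p H)
    exact ⟨m, Subtype.ext (by rw [AddSubmonoidClass.coe_nsmul, hm, ZeroMemClass.coe_zero])⟩
  -- the conjugation `c_*` restricted to `T`
  have hstab : ∀ t ∈ T, W.conjH1 p H c t ∈ T := fun t ht ↦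
    W.map_conjH1_selmerGroupOver_le_holds p H c ⟨t, ht, rfl⟩
  let cT : T →+ T := ((W.conjH1 p H c).comp T.subtype).codRestrict T fun t ↦ hstab t t.2
  have hcT : ∀ t : T, ((cT t : T) : W.subgroupH1 p H) = W.conjH1 p H c t := fun _ ↦ rfl
  have hcTpow : ∀ (m : ℕ) (t : T),
      (((cT.toIntLinearMap ^ m) t : T) : W.subgroupH1 p H) = W.conjH1 p H (c ^ m) t := by
    intro m
    induction m with
    | zero =>
      intro t
      rw [pow_zero, pow_zero, Module.End.one_apply, W.conjH1_one_holds p H, AddMonoidHom.id_apply]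
    | succ m ih =>
      intro t
      rw [pow_succ, Module.End.mul_apply, ih, pow_succ, W.conjH1_mul_holds p H,
        AddMonoidHom.comp_apply]
      rfl
  -- `(c_*)^{p^n} = id` on `T`: `c^{p^n} = c^{[Γ_K : H]} ∈ H` acts trivially
  have hcpn : c ^ (p ^ n) ∈ H := by rw [← hidx]; exact Subgroup.pow_index_mem H c
  have hcp : ∀ t : T, (cT.toIntLinearMap ^ (p ^ n)) t = t := fun t ↦ by
    apply Subtype.ext
    rw [hcTpow, W.conjH1_of_mem_holds p H hcpn, AddMonoidHom.id_apply]
  -- the invariants of `c_*` in `T`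
  let K' : AddSubgroup T := (W.selmerGroupOverInvariants p H).comap T.subtype
  have hK' : ∀ t : T, t ∈ K' ↔ cT t = t := fun t ↦ by
    rw [AddSubgroup.mem_comap, mem_selmerGroupOverInvariants_iff, Subtype.ext_iff, hcT]
    refine ⟨fun h ↦ h.2 c, fun h ↦ ⟨t.2, fun g ↦ ?_⟩⟩
    exact conjH1_eq_self_of_generator H (M := geomPrimaryTorsion W p) hc h g
  -- invariants: `K' ≃ Sel^G`
  have hle : W.selmerGroupOverInvariants p H ≤ T := fun y hy ↦
    ((W.mem_selmerGroupOverInvariants_iff p H y).mp hy).1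
  have eK : K' ≃+ W.selmerGroupOverInvariants p H :=
    { toFun := fun t ↦ ⟨((t : T) : W.subgroupH1 p H), t.2⟩
      invFun := fun y ↦ ⟨⟨y, hle y.2⟩, y.2⟩
      left_inv := fun _ ↦ rfl
      right_inv := fun _ ↦ rfl
      map_add' := fun _ _ ↦ rfl }
  have hmemT : ∀ x : (W.selmerGroupOverInvariants p H)[(p : ℤ)],
      (⟨_, hle (x : W.selmerGroupOverInvariants p H).2⟩ : T) ∈ T[(p : ℤ)] := fun x ↦ by
    have hx := congrArg Subtype.val (AddSubgroup.torsionBy.nsmul_iff.mp x.2)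
    rw [AddSubgroup.torsionBy.nsmul_iff]
    apply Subtype.ext
    simpa using hx
  haveI : Finite (W.selmerGroupOverInvariants p H)[(p : ℤ)] :=
    Finite.of_injective (fun x : (W.selmerGroupOverInvariants p H)[(p : ℤ)] ↦
      (⟨_, hmemT x⟩ : T[(p : ℤ)])) fun x y hxy ↦ by
        have h1 := congrArg (fun z : T[(p : ℤ)] ↦ ((z : T) : W.subgroupH1 p H)) hxy
        exact Subtype.ext (Subtype.ext h1)
  -- Lemma 4.14 and the parity of the invariants
  have h414 := W.selmerCorank_eq_zpCorank_selmerGroupOverInvariants p H hH inferInstance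
  have hpar := zpCorank_mod_two_eq_of_pow_prime_pow_eq_id hTprim hp2 cT n hcp K' hK'
  rw [h414, ← zpCorank_congr eK p, ← hpar]

end WeierstrassCurve
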